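import Summits.KontsevichZagierPeriods.KontsevichZagierPeriods.Theorems.HurwitzMicroSectorsHurwitzSectorComplementStubPairValueAlgebraic

/-!
# Crux `HurwitzSectorComplement` (stmt-KontsevichZagierPeriods-14341), line
# `chebyshev-level-deformation`: stub `stub_partialFractions`

Real-cyclotomic partial fractions of the symmetric pair integrands. For `0 < a < L`, `0 ≤ t < 1`:

* `(t^{a-1} + t^{L-1-a})/(1 - t^L) = (2/L) Σ_{j<L} cos(2πja/L)·(cos(2πj/L) − t)/(1 − 2cos(2πj/L)t + t²)`,
* `(t^{a-1} − t^{L-1-a})/(1 - t^L) = (2/L) Σ_{j<L} sin(2πja/L)·sin(2πj/L)/(1 − 2cos(2πj/L)t + t²)`,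

and, for `0 < u < π` and all real `t`, the half-angle (`v = tan(u/2)`) forms of the two Chebyshev
kernels `(cos u − t)/(1 − 2t cos u + t²)` and `sin u/(1 − 2t cos u + t²)`.

Proof: the Chebyshev generating functions `Σ_{n≥0} cos((n+1)u) tⁿ = (cos u − t)/(1 − 2t cos u + t²)`,
`Σ_{n≥0} sin((n+1)u) tⁿ = sin u/(1 − 2t cos u + t²)` (real and imaginary parts of the complex
geometric series `e^{iu}/(1 − t e^{iu})`), orthogonality of the characters of `ℤ/L` in the real form
`𝟙(n ≡ ±a mod L) = (1/L) Σ_{j<L} cos(2πj(n ∓ a)/L)` (tree: `PairValueAlgebraic.ite_mod_eq_eq_sum_cos`,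
`PairValueAlgebraic.ite_mod_eq_sub_eq_sum_cos`), the product-to-sum formulas, and uniqueness of sums
of the two arithmetic progressions `Σ_k t^{Lk + a − 1} = t^{a−1}/(1 − t^L)`,
`Σ_k t^{Lk + L − 1 − a} = t^{L−1−a}/(1 − t^L)`. The half-angle forms are Mathlib's
`cos u = (1 − v²)/(1 + v²)`, `sin u = 2v/(1 + v²)`. No new definitions; helpers live in the
sub-namespace `PartialFractions`. [folklore]
-/

noncomputable section

open scoped BigOperators
open Real

namespace Summit.KontsevichZagierPeriods.Theorems.HurwitzMicroSectorsHurwitzSectorComplement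

namespace PartialFractions

/-! ### Step 1: the Chebyshev generating functions -/

/-- The Poisson denominator is positive: `0 < 1 − 2t cos u + t²` for `0 ≤ t < 1`. [folklore] -/
theorem den_pos {t : ℝ} (ht0 : 0 ≤ t) (ht1 : t < 1) (u : ℝ) :
    0 < 1 - 2 * Real.cos u * t + t ^ 2 := by
  have h1 : 0 ≤ t * (1 - Real.cos u) := mul_nonneg ht0 (by linarith [Real.cos_le_one u])
  have h2 : 0 < (1 - t) ^ 2 := pow_pos (by linarith) 2
  nlinarith

-- adapted from Literature/Analysis/SpecialFunctions/CotangentMoments.lean (`hasSum_abelCotKernel`)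
/-- **Chebyshev generating functions.** For `0 ≤ t < 1` and real `u`:
`Σ_{n≥0} tⁿ cos((n+1)u) = (cos u − t)/(1 − 2t cos u + t²)` and
`Σ_{n≥0} tⁿ sin((n+1)u) = sin u/(1 − 2t cos u + t²)` (real and imaginary parts of
`Σ tⁿ e^{i(n+1)u} = e^{iu}/(1 − t e^{iu})`). [folklore] -/
theorem hasSum_cos_sin_geom {t : ℝ} (ht0 : 0 ≤ t) (ht1 : t < 1) (u : ℝ) :
    HasSum (fun n : ℕ => t ^ n * Real.cos (((n : ℝ) + 1) * u))
        ((Real.cos u - t) / (1 - 2 * Real.cos u * t + t ^ 2)) ∧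
      HasSum (fun n : ℕ => t ^ n * Real.sin (((n : ℝ) + 1) * u))
        (Real.sin u / (1 - 2 * Real.cos u * t + t ^ 2)) := by
  set z : ℂ := (t : ℂ) * Complex.exp (u * Complex.I) with hz
  have hz_norm : ‖z‖ < 1 := by
    rw [hz, norm_mul, Complex.norm_real, Complex.norm_exp_ofReal_mul_I, mul_one, Real.norm_eq_abs,
      abs_of_nonneg ht0]
    exact ht1
  have hgeom := (hasSum_geometric_of_norm_lt_one hz_norm).mul_left (Complex.exp (u * Complex.I))
  have hterm : ∀ n : ℕ, Complex.exp (u * Complex.I) * z ^ n =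
      ((t ^ n : ℝ) : ℂ) * Complex.exp ((((n : ℝ) + 1) * u : ℝ) * Complex.I) := by
    intro n
    have : Complex.exp ((((n : ℝ) + 1) * u : ℝ) * Complex.I) =
        Complex.exp (u * Complex.I) * Complex.exp (u * Complex.I) ^ n := by
      rw [← Complex.exp_nat_mul, ← Complex.exp_add]
      congr 1
      push_cast
      ring
    rw [this, hz, mul_pow, Complex.ofReal_pow]
    ring
  have hre : ∀ n : ℕ, (Complex.exp (u * Complex.I) * z ^ n).re = t ^ n * Real.cos (((n : ℝ) + 1) * u) := by
    intro n
    rw [hterm, Complex.re_ofReal_mul, Complex.exp_ofReal_mul_I_re]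
  have him : ∀ n : ℕ, (Complex.exp (u * Complex.I) * z ^ n).im = t ^ n * Real.sin (((n : ℝ) + 1) * u) := by
    intro n
    rw [hterm, Complex.im_ofReal_mul, Complex.exp_ofReal_mul_I_im]
  have hzre : z.re = t * Real.cos u := by
    rw [hz, Complex.re_ofReal_mul, Complex.exp_ofReal_mul_I_re]
  have hzim : z.im = t * Real.sin u := by
    rw [hz, Complex.im_ofReal_mul, Complex.exp_ofReal_mul_I_im]
  have hden := den_pos ht0 ht1 u
  have hpy := Real.sin_sq_add_cos_sq u
  have hN : Complex.normSq (1 - z) = 1 - 2 * Real.cos u * t + t ^ 2 := by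
    rw [Complex.normSq_apply]
    simp only [Complex.sub_re, Complex.one_re, Complex.sub_im, Complex.one_im, hzre, hzim]
    linear_combination t ^ 2 * hpy
  have hvre : (Complex.exp (u * Complex.I) * (1 - z)⁻¹).re =
      (Real.cos u - t) / (1 - 2 * Real.cos u * t + t ^ 2) := by
    rw [Complex.mul_re, Complex.inv_re, Complex.inv_im, hN, Complex.exp_ofReal_mul_I_re,
      Complex.exp_ofReal_mul_I_im]
    simp only [Complex.sub_re, Complex.one_re, Complex.sub_im, Complex.one_im, hzre, hzim]
    have key : Real.cos u * (1 - t * Real.cos u) - t * Real.sin u ^ 2 = Real.cos u - t := by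
      linear_combination (-t) * hpy
    calc Real.cos u * ((1 - t * Real.cos u) / (1 - 2 * Real.cos u * t + t ^ 2)) -
          Real.sin u * (-(0 - t * Real.sin u) / (1 - 2 * Real.cos u * t + t ^ 2))
          = (Real.cos u * (1 - t * Real.cos u) - t * Real.sin u ^ 2) /
              (1 - 2 * Real.cos u * t + t ^ 2) := by ring
      _ = (Real.cos u - t) / (1 - 2 * Real.cos u * t + t ^ 2) := by rw [key]
  have hvim : (Complex.exp (u * Complex.I) * (1 - z)⁻¹).im =
      Real.sin u / (1 - 2 * Real.cos u * t + t ^ 2) := by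
    rw [Complex.mul_im, Complex.inv_re, Complex.inv_im, hN, Complex.exp_ofReal_mul_I_re,
      Complex.exp_ofReal_mul_I_im]
    simp only [Complex.sub_re, Complex.one_re, Complex.sub_im, Complex.one_im, hzre, hzim]
    have key : Real.cos u * (t * Real.sin u) + Real.sin u * (1 - t * Real.cos u) = Real.sin u := by
      ring
    calc Real.cos u * (-(0 - t * Real.sin u) / (1 - 2 * Real.cos u * t + t ^ 2)) +
          Real.sin u * ((1 - t * Real.cos u) / (1 - 2 * Real.cos u * t + t ^ 2))
          = (Real.cos u * (t * Real.sin u) + Real.sin u * (1 - t * Real.cos u)) /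
              (1 - 2 * Real.cos u * t + t ^ 2) := by ring
      _ = Real.sin u / (1 - 2 * Real.cos u * t + t ^ 2) := by rw [key]
  constructor
  · have h := Complex.hasSum_re hgeom
    simp only [hre, hvre] at h
    exact h
  · have h := Complex.hasSum_im hgeom
    simp only [him, hvim] at h
    exact h

/-! ### Step 2: orthogonality, parity-split -/

/-- `𝟙(n+1 ≡ a) + 𝟙(n+1 ≡ −a) = (2/L) Σ_{j<L} cos(2πja/L) cos((n+1)·2πj/L)` (`0 < a < L`).
[folklore] -/
theorem ite_add_ite (L a n : ℕ) (ha : 0 < a) (haL : a < L) :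
    (if (n + 1) % L = a then (1 : ℝ) else 0) + (if (n + 1) % L = L - a then (1 : ℝ) else 0) =
      2 / L * ∑ j ∈ Finset.range L,
        Real.cos (2 * π * j * a / L) * Real.cos (((n : ℝ) + 1) * (2 * π * j / L)) := by
  rw [PairValueAlgebraic.ite_mod_eq_eq_sum_cos L a (n + 1) haL,
    PairValueAlgebraic.ite_mod_eq_sub_eq_sum_cos L a (n + 1) ha haL, ← mul_add,
    ← Finset.sum_add_distrib, Finset.mul_sum, Finset.mul_sum]
  refine Finset.sum_congr rfl fun j _ => ?_
  have e1 : 2 * π * j * (((n + 1 : ℕ) : ℝ) - a) / L =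
      ((n : ℝ) + 1) * (2 * π * j / L) - 2 * π * j * a / L := by
    push_cast
    ring
  have e2 : 2 * π * j * (((n + 1 : ℕ) : ℝ) + a) / L =
      ((n : ℝ) + 1) * (2 * π * j / L) + 2 * π * j * a / L := by
    push_cast
    ring
  rw [e1, e2, Real.cos_sub, Real.cos_add]
  ring

/-- `𝟙(n+1 ≡ a) − 𝟙(n+1 ≡ −a) = (2/L) Σ_{j<L} sin(2πja/L) sin((n+1)·2πj/L)` (`0 < a < L`).
[folklore] -/
theorem ite_sub_ite (L a n : ℕ) (ha : 0 < a) (haL : a < L) :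
    (if (n + 1) % L = a then (1 : ℝ) else 0) - (if (n + 1) % L = L - a then (1 : ℝ) else 0) =
      2 / L * ∑ j ∈ Finset.range L,
        Real.sin (2 * π * j * a / L) * Real.sin (((n : ℝ) + 1) * (2 * π * j / L)) := by
  rw [PairValueAlgebraic.ite_mod_eq_eq_sum_cos L a (n + 1) haL,
    PairValueAlgebraic.ite_mod_eq_sub_eq_sum_cos L a (n + 1) ha haL, ← mul_sub,
    ← Finset.sum_sub_distrib, Finset.mul_sum, Finset.mul_sum]
  refine Finset.sum_congr rfl fun j _ => ?_
  have e1 : 2 * π * j * (((n + 1 : ℕ) : ℝ) - a) / L =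
      ((n : ℝ) + 1) * (2 * π * j / L) - 2 * π * j * a / L := by
    push_cast
    ring
  have e2 : 2 * π * j * (((n + 1 : ℕ) : ℝ) + a) / L =
      ((n : ℝ) + 1) * (2 * π * j / L) + 2 * π * j * a / L := by
    push_cast
    ring
  rw [e1, e2, Real.cos_sub, Real.cos_add]
  ring

/-! ### Step 3: sums over the two arithmetic progressions -/

/-- `Σ_{n ≥ 0, n+1 ≡ r (L)} tⁿ = t^{r−1}/(1 − t^L)` for `0 < r < L`, `0 ≤ t < 1` (reindex
`n = Lk + r − 1`, geometric series in `t^L`). [folklore] -/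
theorem hasSum_ite_mul_pow (L r : ℕ) (hr : 0 < r) (hrL : r < L) {t : ℝ} (ht0 : 0 ≤ t)
    (ht1 : t < 1) :
    HasSum (fun n : ℕ => (if (n + 1) % L = r then (1 : ℝ) else 0) * t ^ n)
      (t ^ (r - 1) / (1 - t ^ L)) := by
  have hL : 0 < L := by omega
  have hinj : Function.Injective (fun k : ℕ => L * k + (r - 1)) := by
    intro x y hxy
    exact Nat.eq_of_mul_eq_mul_left hL (Nat.add_right_cancel hxy)
  have hgeom : HasSum (fun k : ℕ => t ^ (r - 1) * (t ^ L) ^ k) (t ^ (r - 1) * (1 - t ^ L)⁻¹) :=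
    (hasSum_geometric_of_lt_one (pow_nonneg ht0 L) (pow_lt_one₀ ht0 ht1 hL.ne')).mul_left _
  rw [div_eq_mul_inv]
  refine (hinj.hasSum_iff ?_).mp ?_
  · intro n hn
    rw [mul_eq_zero]
    left
    rw [if_neg]
    intro hmod
    apply hn
    refine ⟨(n + 1) / L, ?_⟩
    have h := Nat.div_add_mod (n + 1) L
    show L * ((n + 1) / L) + (r - 1) = n
    omega
  · refine hgeom.congr_fun fun k => ?_
    have h1 : (L * k + (r - 1) + 1) % L = r := by
      rw [show L * k + (r - 1) + 1 = L * k + r by omega, Nat.mul_add_mod, Nat.mod_eq_of_lt hrL]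
    simp only [Function.comp_apply]
    rw [if_pos h1, one_mul, ← pow_mul, ← pow_add]
    congr 1
    ring

/-! ### Step 4: the two partial fraction expansions -/

/-- **Symmetric pair.** For `0 < a < L`, `0 ≤ t < 1`:
`(t^{a−1} + t^{L−1−a})/(1 − t^L) = (2/L) Σ_{j<L} cos(2πja/L)(cos(2πj/L) − t)/(1 − 2cos(2πj/L)t + t²)`.
[folklore] -/
theorem partialFraction_cos (L a : ℕ) (ha : 0 < a) (haL : a < L) (t : ℝ) (ht0 : 0 ≤ t)
    (ht1 : t < 1) :
    (t ^ (a - 1) + t ^ (L - 1 - a)) / (1 - t ^ L) =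
      2 / (L : ℝ) * ∑ j ∈ Finset.range L, Real.cos (2 * π * j * a / L) *
        ((Real.cos (2 * π * j / L) - t) / (1 - 2 * Real.cos (2 * π * j / L) * t + t ^ 2)) := by
  have hR : HasSum (fun n : ℕ => 2 / (L : ℝ) * ∑ j ∈ Finset.range L, Real.cos (2 * π * j * a / L) *
      (t ^ n * Real.cos (((n : ℝ) + 1) * (2 * π * j / L))))
      (2 / (L : ℝ) * ∑ j ∈ Finset.range L, Real.cos (2 * π * j * a / L) *
        ((Real.cos (2 * π * j / L) - t) / (1 - 2 * Real.cos (2 * π * j / L) * t + t ^ 2))) :=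
    HasSum.mul_left _ (hasSum_sum fun j _ => HasSum.mul_left _ (hasSum_cos_sin_geom ht0 ht1 _).1)
  have hA := hasSum_ite_mul_pow L a ha haL ht0 ht1
  have hB := hasSum_ite_mul_pow L (L - a) (by omega) (by omega) ht0 ht1
  have hAB := hA.add hB
  rw [show L - a - 1 = L - 1 - a by omega, ← add_div] at hAB
  refine hAB.unique (hR.congr_fun fun n => ?_)
  rw [← add_mul, ite_add_ite L a n ha haL, Finset.mul_sum, Finset.mul_sum, Finset.sum_mul]
  refine Finset.sum_congr rfl fun j _ => ?_
  ring

/-- **Antisymmetric pair.** For `0 < a < L`, `0 ≤ t < 1`: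
`(t^{a−1} − t^{L−1−a})/(1 − t^L) = (2/L) Σ_{j<L} sin(2πja/L) sin(2πj/L)/(1 − 2cos(2πj/L)t + t²)`.
[folklore] -/
theorem partialFraction_sin (L a : ℕ) (ha : 0 < a) (haL : a < L) (t : ℝ) (ht0 : 0 ≤ t)
    (ht1 : t < 1) :
    (t ^ (a - 1) - t ^ (L - 1 - a)) / (1 - t ^ L) =
      2 / (L : ℝ) * ∑ j ∈ Finset.range L, Real.sin (2 * π * j * a / L) *
        (Real.sin (2 * π * j / L) / (1 - 2 * Real.cos (2 * π * j / L) * t + t ^ 2)) := by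
  have hR : HasSum (fun n : ℕ => 2 / (L : ℝ) * ∑ j ∈ Finset.range L, Real.sin (2 * π * j * a / L) *
      (t ^ n * Real.sin (((n : ℝ) + 1) * (2 * π * j / L))))
      (2 / (L : ℝ) * ∑ j ∈ Finset.range L, Real.sin (2 * π * j * a / L) *
        (Real.sin (2 * π * j / L) / (1 - 2 * Real.cos (2 * π * j / L) * t + t ^ 2))) :=
    HasSum.mul_left _ (hasSum_sum fun j _ => HasSum.mul_left _ (hasSum_cos_sin_geom ht0 ht1 _).2)
  have hA := hasSum_ite_mul_pow L a ha haL ht0 ht1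
  have hB := hasSum_ite_mul_pow L (L - a) (by omega) (by omega) ht0 ht1
  have hAB := hA.sub hB
  rw [show L - a - 1 = L - 1 - a by omega, ← sub_div] at hAB
  refine hAB.unique (hR.congr_fun fun n => ?_)
  rw [← sub_mul, ite_sub_ite L a n ha haL, Finset.mul_sum, Finset.mul_sum, Finset.sum_mul]
  refine Finset.sum_congr rfl fun j _ => ?_
  ring

/-! ### Step 5: the half-angle forms of the Chebyshev kernels -/

/-- **Half-angle forms.** For `0 < u < π`, `v = tan(u/2)` and all real `t`:
`(cos u − t)/(1 − 2t cos u + t²) = ((1−t) − v²(1+t))/((1−t)² + v²(1+t)²)` and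
`sin u/(1 − 2t cos u + t²) = 2v/((1−t)² + v²(1+t)²)` (`cos u = (1−v²)/(1+v²)`,
`sin u = 2v/(1+v²)`). [folklore] -/
theorem halfAngle (u t : ℝ) (hu0 : 0 < u) (hupi : u < π) :
    (Real.cos u - t) / (1 - 2 * Real.cos u * t + t ^ 2) =
        ((1 - t) - (Real.tan (u / 2)) ^ 2 * (1 + t)) /
          ((1 - t) ^ 2 + (Real.tan (u / 2)) ^ 2 * (1 + t) ^ 2) ∧
      Real.sin u / (1 - 2 * Real.cos u * t + t ^ 2) =
        2 * Real.tan (u / 2) / ((1 - t) ^ 2 + (Real.tan (u / 2)) ^ 2 * (1 + t) ^ 2) := by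
  have hv0 : 0 < Real.tan (u / 2) :=
    Real.tan_pos_of_pos_of_lt_pi_div_two (by linarith) (by linarith)
  have hc1 : Real.cos u ≠ -1 := by
    have h := Real.cos_lt_cos_of_nonneg_of_le_pi hu0.le le_rfl hupi
    rw [Real.cos_pi] at h
    exact ne_of_gt h
  have hcos := Real.cos_eq_two_mul_tan_half_div_one_sub_tan_half_sq u hc1
  have hsin := Real.sin_eq_two_mul_tan_half_div_one_add_tan_half_sq u
  set v := Real.tan (u / 2) with hv
  have h1 : (0 : ℝ) < 1 + v ^ 2 := by positivity
  have hden : 0 < (1 - t) ^ 2 + v ^ 2 * (1 + t) ^ 2 := by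
    rcases eq_or_ne t 1 with rfl | ht
    · norm_num
      positivity
    · have : 0 < (1 - t) ^ 2 := sq_pos_of_ne_zero (sub_ne_zero.2 ht.symm)
      positivity
  have hD : 1 - 2 * Real.cos u * t + t ^ 2 = ((1 - t) ^ 2 + v ^ 2 * (1 + t) ^ 2) / (1 + v ^ 2) := by
    rw [hcos]
    field_simp
    ring
  rw [hD, hcos, hsin, div_eq_div_iff (div_pos hden h1).ne' hden.ne',
    div_eq_div_iff (div_pos hden h1).ne' hden.ne']
  constructor
  · field_simp
    ring
  · field_simp

end PartialFractions

open PartialFractions in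
/-- **S4, partial fractions.** For `0 < a < L` and `0 ≤ t < 1`: the symmetric pair integrand
`(t^{a−1} + t^{L−1−a})/(1−t^L) = (2/L) Σ_{j<L} cos(2πja/L)·(cos(2πj/L) − t)/(1 − 2cos(2πj/L)t + t²)`,
the antisymmetric one `(t^{a−1} − t^{L−1−a})/(1−t^L) = (2/L) Σ_{j<L} sin(2πja/L) sin(2πj/L)/(1 − 2cos(2πj/L)t + t²)`
(generating functions `Σ cos(nu)t^{n−1}`, `Σ sin(nu)t^{n−1}` and orthogonality of characters of
`ℤ/L`), and the half-angle forms of the two Chebyshev kernels (`v = tan(u/2)`,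
`cos u = (1−v²)/(1+v²)`, `sin u = 2v/(1+v²)`). [folklore] -/
theorem stub_partialFractions :
    (∀ (L a : ℕ), 0 < a → a < L → ∀ (t : ℝ), 0 ≤ t → t < 1 →
      (t ^ (a - 1) + t ^ (L - 1 - a)) / (1 - t ^ L) =
        2 / (L : ℝ) * ∑ j ∈ Finset.range L, Real.cos (2 * Real.pi * j * a / L) *
          ((Real.cos (2 * Real.pi * j / L) - t) / (1 - 2 * Real.cos (2 * Real.pi * j / L) * t + t ^ 2))) ∧
    (∀ (L a : ℕ), 0 < a → a < L → ∀ (t : ℝ), 0 ≤ t → t < 1 →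
      (t ^ (a - 1) - t ^ (L - 1 - a)) / (1 - t ^ L) =
        2 / (L : ℝ) * ∑ j ∈ Finset.range L, Real.sin (2 * Real.pi * j * a / L) *
          (Real.sin (2 * Real.pi * j / L) / (1 - 2 * Real.cos (2 * Real.pi * j / L) * t + t ^ 2))) ∧
    (∀ (u t : ℝ), 0 < u → u < Real.pi →
      (Real.cos u - t) / (1 - 2 * Real.cos u * t + t ^ 2) =
        ((1 - t) - (Real.tan (u / 2)) ^ 2 * (1 + t)) / ((1 - t) ^ 2 + (Real.tan (u / 2)) ^ 2 * (1 + t) ^ 2) ∧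
      Real.sin u / (1 - 2 * Real.cos u * t + t ^ 2) =
        2 * Real.tan (u / 2) / ((1 - t) ^ 2 + (Real.tan (u / 2)) ^ 2 * (1 + t) ^ 2)) :=
  ⟨fun L a ha haL t ht0 ht1 => partialFraction_cos L a ha haL t ht0 ht1,
    fun L a ha haL t ht0 ht1 => partialFraction_sin L a ha haL t ht0 ht1,
    fun u t hu0 hupi => halfAngle u t hu0 hupi⟩

end Summit.KontsevichZagierPeriods.Theorems.HurwitzMicroSectorsHurwitzSectorComplement

end
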